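import Mathlib
import Literature.Analysis.PDE.TrueKernelElement
import Literature.Analysis.PDE.FarKernelSpanLemmas
import HarnessLib

/-!
# The span of the true kernel elements: combination-level facts

Analysis/PDE support file (everything proved). `lincomb_kernel`: given finitely many global `C²`
functions `B_x` solving `p_tt − p_xx + P p = 0` on `{x ≥ 1}`, each a `t`-polynomial on
`{x ≥ 7/8}`, each with data `ε`-close in `P`-energy to a model datum and with finite,
non-radiating exterior energy (the output of `TrueKernelElement.lean`, or the zero function with
zero model), every combination `k = Σ_x a_x B_x` has the same properties with model datum
`Σ_x a_x (model_x)` and closeness constant `#u · K · Σ a_x²` (Cauchy–Schwarz,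
`FarKernelSpanLemmas.lean`). `exists_farKernelSpan` instantiates this with the position elements
(`ν = 0`, even `m ≤ n`, model `x^{m−n}`) and velocity elements (`ν = 1`, even `m ≤ n − 1`),
producing the comparison family `k_{α,β}` of the far-side channel estimate of `FixedModeChannels`
(route PhotonSphereChannels, stmt-FinalStateConjecture-10048). Folklore.
-/

noncomputable section

namespace Literature.Analysis.PDE

open MeasureTheory Set Filter Topology Finset Real Literature.Analysis.Calculus

/-- Structure: a combination of `t`-polynomials on `{z ≥ 7/8}` is a `t`-polynomial there.
[folklore] -/
theorem lincomb_structure {ι : Type*} (u : Finset ι) {B : ι → ℝ → ℝ → ℝ}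
    (hst : ∀ x ∈ u, ∃ (N : ℕ) (A : ℕ → ℝ → ℝ), ∀ t z, (7 / 8 : ℝ) ≤ z →
      B x t z = ∑ i ∈ range N, A i z * t ^ i) (a : ι → ℝ) :
    ∃ (N : ℕ) (A : ℕ → ℝ → ℝ), ∀ t z, (7 / 8 : ℝ) ≤ z →
      (∑ x ∈ u, a x * B x t z) = ∑ i ∈ range N, A i z * t ^ i := by
  have hst' : ∀ x, ∃ (N : ℕ) (A : ℕ → ℝ → ℝ), x ∈ u → ∀ t z, (7 / 8 : ℝ) ≤ z →
      B x t z = ∑ i ∈ range N, A i z * t ^ i := by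
    intro x
    by_cases hx : x ∈ u
    · obtain ⟨N, A, h⟩ := hst x hx; exact ⟨N, A, fun _ => h⟩
    · exact ⟨0, fun _ _ => 0, fun h => absurd h hx⟩
  choose Nf Af hAf using hst'
  refine ⟨∑ x ∈ u, Nf x, fun i z => ∑ x ∈ u, a x * (if i < Nf x then Af x i z else 0),
    fun t z hz => ?_⟩
  have hN : ∀ x ∈ u, Nf x ≤ ∑ y ∈ u, Nf y := fun x hx =>
    Finset.single_le_sum (f := Nf) (fun _ _ => Nat.zero_le _) hx
  simp_rw [Finset.sum_mul]
  rw [Finset.sum_comm]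
  refine Finset.sum_congr rfl fun x hx => ?_
  rw [hAf x hx t z hz, Finset.mul_sum]
  rw [← Finset.sum_subset (Finset.range_subset_range.2 (hN x hx)) (fun i _ hi => by
    have : ¬ i < Nf x := fun h => hi (mem_range.2 h)
    simp [this])]
  refine Finset.sum_congr rfl fun i hi => ?_
  simp [mem_range.1 hi]; ring

/-- Closeness of the data of a combination to the combined model datum (Cauchy–Schwarz).
[folklore] -/
theorem lincomb_closeness {ι : Type*} (u : Finset ι) {B : ι → ℝ → ℝ → ℝ}
    {f₀ f₁ g₀ : ι → ℝ → ℝ} {P : ℝ → ℝ} (hPc : Continuous P) (hP0 : ∀ z, 0 ≤ P z) {Kel : ℝ}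
    (hC : ∀ x ∈ u, ContDiff ℝ 2 (Function.uncurry (B x)))
    (hmodc : ∀ x ∈ u, ContinuousOn (f₀ x) (Ioi 1) ∧ ContinuousOn (f₁ x) (Ioi 1) ∧
      ContinuousOn (g₀ x) (Ioi 1))
    (hclI : ∀ x ∈ u, IntegrableOn (fun z => (deriv (B x 0) z - f₁ x z) ^ 2
      + P z * (B x 0 z - f₀ x z) ^ 2 + (deriv (fun τ => B x τ z) 0 - g₀ x z) ^ 2) (Ioi 1))
    (hcl : ∀ x ∈ u, (∫ z in Ioi 1, ((deriv (B x 0) z - f₁ x z) ^ 2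
      + P z * (B x 0 z - f₀ x z) ^ 2 + (deriv (fun τ => B x τ z) 0 - g₀ x z) ^ 2)) ≤ Kel)
    (a : ι → ℝ) {k : ℝ → ℝ → ℝ} (hkdef : k = fun t z => ∑ x ∈ u, a x * B x t z) :
    IntegrableOn (fun z => (deriv (k 0) z - ∑ x ∈ u, a x * f₁ x z) ^ 2
      + P z * (k 0 z - ∑ x ∈ u, a x * f₀ x z) ^ 2
      + (deriv (fun τ => k τ z) 0 - ∑ x ∈ u, a x * g₀ x z) ^ 2) (Ioi 1) ∧
    (∫ z in Ioi 1, ((deriv (k 0) z - ∑ x ∈ u, a x * f₁ x z) ^ 2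
      + P z * (k 0 z - ∑ x ∈ u, a x * f₀ x z) ^ 2
      + (deriv (fun τ => k τ z) 0 - ∑ x ∈ u, a x * g₀ x z) ^ 2))
        ≤ u.card * Kel * ∑ x ∈ u, a x ^ 2 := by
  subst hkdef
  set k : ℝ → ℝ → ℝ := fun t z => ∑ x ∈ u, a x * B x t z with hk
  have hkC : ContDiff ℝ 2 (Function.uncurry k) := contDiff_two_lincomb u a hC
  have hcard0 : (0 : ℝ) ≤ u.card := Nat.cast_nonneg _
  have hd : ∀ x ∈ u, ∀ t z, DifferentiableAt ℝ (fun τ => B x τ z) t ∧ DifferentiableAt ℝ (B x t) z :=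
    fun x hx t z => ⟨(contDiff_two_slices'' (hC x hx) t z).1.differentiable (by norm_num) t,
      (contDiff_two_slices'' (hC x hx) t z).2.differentiable (by norm_num) z⟩
  have hDz : ∀ z, deriv (k 0) z = ∑ x ∈ u, a x * deriv (B x 0) z := fun z =>
    (HasDerivAt.fun_sum (u := u) (A := fun x y => a x * B x 0 y)
      (A' := fun x => a x * deriv (B x 0) z) (x := z)
      fun x hx => ((hd x hx 0 z).2.hasDerivAt).const_mul (a x)).deriv
  have hDt : ∀ z, deriv (fun τ => k τ z) 0 = ∑ x ∈ u, a x * deriv (fun τ => B x τ z) 0 := fun z =>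
    (HasDerivAt.fun_sum (u := u) (A := fun x τ => a x * B x τ z)
      (A' := fun x => a x * deriv (fun τ => B x τ z) 0) (x := (0:ℝ))
      fun x hx => ((hd x hx 0 z).1.hasDerivAt).const_mul (a x)).deriv
  set I : ι → ℝ → ℝ := fun x z => (deriv (B x 0) z - f₁ x z) ^ 2
    + P z * (B x 0 z - f₀ x z) ^ 2 + (deriv (fun τ => B x τ z) 0 - g₀ x z) ^ 2 with hI
  set Ik : ℝ → ℝ := fun z => (deriv (k 0) z - ∑ x ∈ u, a x * f₁ x z) ^ 2
      + P z * (k 0 z - ∑ x ∈ u, a x * f₀ x z) ^ 2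
      + (deriv (fun τ => k τ z) 0 - ∑ x ∈ u, a x * g₀ x z) ^ 2 with hIk
  have hIk_le : ∀ z, Ik z ≤ u.card * ∑ x ∈ u, a x ^ 2 * I x z := by
    intro z
    have e1 : deriv (k 0) z - ∑ x ∈ u, a x * f₁ x z = ∑ x ∈ u, a x * (deriv (B x 0) z - f₁ x z) := by
      rw [hDz, ← Finset.sum_sub_distrib]; refine Finset.sum_congr rfl fun x _ => by ring
    have e2 : k 0 z - ∑ x ∈ u, a x * f₀ x z = ∑ x ∈ u, a x * (B x 0 z - f₀ x z) := by
      show (∑ x ∈ u, a x * B x 0 z) - _ = _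
      rw [← Finset.sum_sub_distrib]; refine Finset.sum_congr rfl fun x _ => by ring
    have e3 : deriv (fun τ => k τ z) 0 - ∑ x ∈ u, a x * g₀ x z
        = ∑ x ∈ u, a x * (deriv (fun τ => B x τ z) 0 - g₀ x z) := by
      rw [hDt, ← Finset.sum_sub_distrib]; refine Finset.sum_congr rfl fun x _ => by ring
    simp only [hIk, hI]
    rw [e1, e2, e3]
    have h1 := sq_lincomb_le u a (fun x => deriv (B x 0) z - f₁ x z)
    have h2 := mul_le_mul_of_nonneg_left (sq_lincomb_le u a (fun x => B x 0 z - f₀ x z)) (hP0 z)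
    have h3 := sq_lincomb_le u a (fun x => deriv (fun τ => B x τ z) 0 - g₀ x z)
    calc (∑ x ∈ u, a x * (deriv (B x 0) z - f₁ x z)) ^ 2
          + P z * (∑ x ∈ u, a x * (B x 0 z - f₀ x z)) ^ 2
          + (∑ x ∈ u, a x * (deriv (fun τ => B x τ z) 0 - g₀ x z)) ^ 2
        ≤ u.card * ∑ x ∈ u, a x ^ 2 * (deriv (B x 0) z - f₁ x z) ^ 2
          + P z * (u.card * ∑ x ∈ u, a x ^ 2 * (B x 0 z - f₀ x z) ^ 2)
          + u.card * ∑ x ∈ u, a x ^ 2 * (deriv (fun τ => B x τ z) 0 - g₀ x z) ^ 2 := by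
          linarith
      _ = u.card * ∑ x ∈ u, a x ^ 2 * ((deriv (B x 0) z - f₁ x z) ^ 2
          + P z * (B x 0 z - f₀ x z) ^ 2 + (deriv (fun τ => B x τ z) 0 - g₀ x z) ^ 2) := by
          rw [Finset.mul_sum, Finset.mul_sum, Finset.mul_sum, Finset.mul_sum, Finset.mul_sum,
            ← Finset.sum_add_distrib, ← Finset.sum_add_distrib]
          refine Finset.sum_congr rfl fun x _ => ?_
          ring
  have hIk_nn : ∀ z, 0 ≤ Ik z := fun z => by simp only [hIk]; have := hP0 z; positivity
  obtain ⟨kt, kx, -, -, -, hctk, -, -, -, -, hk1, -, -, -, -, -, -, -⟩ :=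
    exists_partials_of_contDiff_two hkC
  have hIk_c : ContinuousOn Ik (Ioi 1) := by
    have c1 : Continuous fun z => deriv (k 0) z := (contDiff_two_slices'' hkC 0 0).2.continuous_deriv
      (by norm_num)
    have c2 : Continuous fun z => deriv (fun τ => k τ z) 0 := by
      have : (fun z => deriv (fun τ => k τ z) 0) = fun z => kt 0 z := funext fun z => (hk1 0 z).deriv
      rw [this]; exact hctk.comp (continuous_const.prodMk continuous_id)
    have c3 : Continuous fun z => k 0 z := (contDiff_two_slices'' hkC 0 0).2.continuous
    have cs : ∀ (f : ι → ℝ → ℝ), (∀ x ∈ u, ContinuousOn (f x) (Ioi 1)) →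
        ContinuousOn (fun z => ∑ x ∈ u, a x * f x z) (Ioi 1) := fun f hf =>
      continuousOn_finsetSum _ fun x hx => continuousOn_const.mul (hf x hx)
    simp only [hIk]
    exact (((c1.continuousOn.sub (cs _ fun x hx => (hmodc x hx).2.1)).pow 2).add
      (hPc.continuousOn.mul ((c3.continuousOn.sub (cs _ fun x hx => (hmodc x hx).1)).pow 2))).add
      ((c2.continuousOn.sub (cs _ fun x hx => (hmodc x hx).2.2)).pow 2)
  have hG_int : IntegrableOn (fun z => (u.card : ℝ) * ∑ x ∈ u, a x ^ 2 * I x z) (Ioi 1) :=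
    (integrable_finsetSum _ fun x hx => (hclI x hx).const_mul (a x ^ 2)).const_mul _
  have hIk_int : IntegrableOn Ik (Ioi 1) :=
    Integrable.mono' hG_int (hIk_c.aestronglyMeasurable measurableSet_Ioi)
      ((ae_restrict_iff' measurableSet_Ioi).2 (ae_of_all _ fun z _ => by
        rw [Real.norm_eq_abs, abs_of_nonneg (hIk_nn z)]; exact hIk_le z))
  refine ⟨hIk_int, ?_⟩
  calc (∫ z in Ioi 1, Ik z) ≤ ∫ z in Ioi 1, (u.card : ℝ) * ∑ x ∈ u, a x ^ 2 * I x z :=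
        setIntegral_mono_on hIk_int hG_int measurableSet_Ioi fun z _ => hIk_le z
    _ = u.card * ∑ x ∈ u, a x ^ 2 * ∫ z in Ioi 1, I x z := by
        rw [MeasureTheory.integral_const_mul, integral_finsetSum _ fun x hx =>
          (hclI x hx).const_mul (a x ^ 2)]
        congr 1; refine Finset.sum_congr rfl fun x hx => ?_
        exact MeasureTheory.integral_const_mul _ _
    _ ≤ u.card * ∑ x ∈ u, a x ^ 2 * Kel := by
        refine mul_le_mul_of_nonneg_left (Finset.sum_le_sum fun x hx => ?_) hcard0
        exact mul_le_mul_of_nonneg_left (hcl x hx) (sq_nonneg _)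
    _ = u.card * Kel * ∑ x ∈ u, a x ^ 2 := by rw [← Finset.sum_mul]; ring

/-- Energies of a combination `k = Σ a_x B_x`: integrable, dominated, and non-radiating.
[folklore] -/
theorem lincomb_energies {ι : Type*} (u : Finset ι) {B : ι → ℝ → ℝ → ℝ}
    {P : ℝ → ℝ} (hPc : Continuous P) (hP0 : ∀ z, 0 ≤ P z)
    (hC : ∀ x ∈ u, ContDiff ℝ 2 (Function.uncurry (B x)))
    (hEt : ∀ x ∈ u, ∀ t, IntegrableOn (fun z => deriv (fun τ => B x τ z) t ^ 2 + deriv (B x t) z ^ 2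
      + P z * B x t z ^ 2) (Ioi (1 + |t|)))
    (htop : ∀ x ∈ u, Tendsto (fun t => ∫ z in Ioi (1 + |t|),
      (deriv (fun τ => B x τ z) t ^ 2 + deriv (B x t) z ^ 2 + P z * B x t z ^ 2)) atTop (𝓝 0))
    (hbot : ∀ x ∈ u, Tendsto (fun t => ∫ z in Ioi (1 + |t|),
      (deriv (fun τ => B x τ z) t ^ 2 + deriv (B x t) z ^ 2 + P z * B x t z ^ 2)) atBot (𝓝 0))
    (a : ι → ℝ) {k : ℝ → ℝ → ℝ} (hk : k = fun t z => ∑ x ∈ u, a x * B x t z) :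
    (∫⁻ z in Ioi 1, ENNReal.ofReal (deriv (fun τ => k τ z) 0 ^ 2 + deriv (k 0) z ^ 2
      + P z * k 0 z ^ 2)) < ⊤ ∧
    (∀ t, IntegrableOn (fun z => deriv (fun τ => k τ z) t ^ 2 + deriv (k t) z ^ 2
      + P z * k t z ^ 2) (Ioi (1 + |t|))) ∧
    Tendsto (fun t => ∫ z in Ioi (1 + |t|),
      (deriv (fun τ => k τ z) t ^ 2 + deriv (k t) z ^ 2 + P z * k t z ^ 2)) atTop (𝓝 0) ∧
    Tendsto (fun t => ∫ z in Ioi (1 + |t|),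
      (deriv (fun τ => k τ z) t ^ 2 + deriv (k t) z ^ 2 + P z * k t z ^ 2)) atBot (𝓝 0) := by
  have hkC : ContDiff ℝ 2 (Function.uncurry k) := by rw [hk]; exact contDiff_two_lincomb u a hC
  have hEk_le : ∀ t z, deriv (fun τ => k τ z) t ^ 2 + deriv (k t) z ^ 2 + P z * k t z ^ 2
      ≤ u.card * ∑ x ∈ u, a x ^ 2 *
        (deriv (fun τ => B x τ z) t ^ 2 + deriv (B x t) z ^ 2 + P z * B x t z ^ 2) := by
    intro t z
    have h := wave1D_energyDensity_lincomb_le u a hC t z (hP0 z)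
    rw [hk]; exact h
  have hEk_c : ∀ t, Continuous fun z => deriv (fun τ => k τ z) t ^ 2 + deriv (k t) z ^ 2
      + P z * k t z ^ 2 := fun t =>
    (continuous_wave1D_energyDensity hPc hkC).comp (continuous_const.prodMk continuous_id)
  have hEk_nn : ∀ t z, 0 ≤ deriv (fun τ => k τ z) t ^ 2 + deriv (k t) z ^ 2 + P z * k t z ^ 2 :=
    fun t z => wave1D_energyDensity_nonneg hP0 t z
  have hmaj : ∀ t, IntegrableOn (fun z => (u.card : ℝ) * ∑ x ∈ u, a x ^ 2 *
      (deriv (fun τ => B x τ z) t ^ 2 + deriv (B x t) z ^ 2 + P z * B x t z ^ 2))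
      (Ioi (1 + |t|)) := fun t =>
    (integrable_finsetSum _ fun x hx => (hEt x hx t).const_mul (a x ^ 2)).const_mul _
  have hEk_int : ∀ t, IntegrableOn (fun z => deriv (fun τ => k τ z) t ^ 2 + deriv (k t) z ^ 2
      + P z * k t z ^ 2) (Ioi (1 + |t|)) := fun t =>
    Integrable.mono' (hmaj t) (hEk_c t).aestronglyMeasurable
      ((ae_restrict_iff' measurableSet_Ioi).2 (ae_of_all _ fun z _ => by
        rw [Real.norm_eq_abs, abs_of_nonneg (hEk_nn t z)]; exact hEk_le t z))
  have hEk_bd : ∀ t, (∫ z in Ioi (1 + |t|), (deriv (fun τ => k τ z) t ^ 2 + deriv (k t) z ^ 2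
      + P z * k t z ^ 2))
      ≤ u.card * ∑ x ∈ u, a x ^ 2 * ∫ z in Ioi (1 + |t|),
        (deriv (fun τ => B x τ z) t ^ 2 + deriv (B x t) z ^ 2 + P z * B x t z ^ 2) := by
    intro t
    refine (setIntegral_mono_on (hEk_int t) (hmaj t) measurableSet_Ioi fun z _ => hEk_le t z).trans
      (le_of_eq ?_)
    rw [MeasureTheory.integral_const_mul, integral_finsetSum _ fun x hx =>
      (hEt x hx t).const_mul (a x ^ 2)]
    congr 1; refine Finset.sum_congr rfl fun x hx => ?_
    exact MeasureTheory.integral_const_mul _ _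
  have hlim : ∀ {l : Filter ℝ}, (∀ x ∈ u, Tendsto (fun t => ∫ z in Ioi (1 + |t|),
      (deriv (fun τ => B x τ z) t ^ 2 + deriv (B x t) z ^ 2 + P z * B x t z ^ 2)) l (𝓝 0)) →
      Tendsto (fun t => ∫ z in Ioi (1 + |t|), (deriv (fun τ => k τ z) t ^ 2 + deriv (k t) z ^ 2
        + P z * k t z ^ 2)) l (𝓝 0) := by
    intro l hl
    have hup : Tendsto (fun t => (u.card : ℝ) * ∑ x ∈ u, a x ^ 2 * ∫ z in Ioi (1 + |t|),
        (deriv (fun τ => B x τ z) t ^ 2 + deriv (B x t) z ^ 2 + P z * B x t z ^ 2)) l (𝓝 0) := by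
      have h := (tendsto_finsetSum u fun x hx => (hl x hx).const_mul (a x ^ 2)).const_mul
        (u.card : ℝ)
      rw [show (u.card : ℝ) * ∑ x ∈ u, a x ^ 2 * (0 : ℝ) = 0 by simp] at h
      exact h
    exact squeeze_zero (fun t => setIntegral_nonneg measurableSet_Ioi fun z _ => hEk_nn t z)
      hEk_bd hup
  have hfin : (∫⁻ z in Ioi 1, ENNReal.ofReal (deriv (fun τ => k τ z) 0 ^ 2 + deriv (k 0) z ^ 2
      + P z * k 0 z ^ 2)) < ⊤ := by
    have h := hEk_int 0
    simp only [abs_zero, add_zero] at h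
    exact h.lintegral_lt_top
  exact ⟨hfin, hEk_int, hlim htop, hlim hbot⟩

end Literature.Analysis.PDE
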